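import Summits.QuantumFields.GaugeBoot.OneOverNFirstOrderIdentity
import Literature.MathematicalPhysics.QuantumFieldTheory.Chatterjee2019LargeN.WilsonLoopFactorization
import HarnessLib

/-!
# First-order factorization of the `1/N` expansion: connected correlations of Wilson loops vanish at order `1/N` (gauge-boot, ADDENDUM 30 part R)

HONEST FRAMING (cell `pub-gaugeboot`, page 1 of every file): the venture produces certified bounds
on lattice expectations at stated coupling, gauge group, dimension and torus size; NOT a mass gap,
NOT a continuum limit, NOT a string tension; NOT Yang–Mills-summit-bearing (barriers
`FixedCouplingUltralocality`, `PerturbativeInvisibility`).  Strong-coupling `SO(N)` lattice gauge theory with free boundary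
condition (S. Chatterjee, Comm. Math. Phys. **366** (2019); S. Chatterjee, J. Jafarov, arXiv:1604.04777); nothing about
four-dimensional continuum Yang–Mills or a mass gap.

## Content

★★★ `firstOrder_factorization` — for `d ≥ 2` and `|β| ≤ β₁(d)`, the first-order coefficient of the `1/N` expansion of Wilson
loop expectations (the lane's `f_1 = F 3`, `oneOverN_master`) obeys the LEIBNIZ RULE over the zeroth one (`f_0 = F 2`, which is
multiplicative by Chatterjee's Corollary 3.2):

  `f_1(l₁, …, lₙ) = Σᵢ f_1(lᵢ) · Π_{j ≠ i} f_0(lⱼ)`,   in particular   `f_1(l₁, l₂) = f_1(l₁) f_0(l₂) + f_0(l₁) f_1(l₂)`,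

i.e. `⟨W_{l₁}⋯W_{lₙ}⟩/Nⁿ` and `Πᵢ ⟨W_{lᵢ}⟩/N` agree up to `o(1/N)`: the connected correlations of normalised Wilson loops are
`o(1/N)` (in fact `O(1/N²)` by the order-two expansion) in the strongly coupled large-`N` `SO(N)` theory — not stated in the
sources (where it would follow from the string representation of `f_1`).  Proof (`firstOrder_factorization_of`, abstract): the
defect `G = f_1 − Q` satisfies the homogeneous equation of the sibling `OneOverNFirstOrderIdentity`, whose extra term is
controlled by the same Catalan-weighted splitting sums (`|Π f_0| ≤ 1`, `Φ((pieces)) ≤ Φ(s')`), so the contraction of ADDENDUM 28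
with constant `θ + 2/K ≤ 5/8` forces `G = 0`.

Everything is `[folklore]` given the siblings.
-/

noncomputable section

open Finset Filter Topology
open Literature.Probability.LatticeModels (Site box)
open Literature.MathematicalPhysics.QuantumLattice (ZdPlaquette)
open Literature.MathematicalPhysics.QuantumFieldTheory (latticeNorm)
open Literature.MathematicalPhysics.QuantumFieldTheory.Chatterjee2019LargeN
open Literature.MathematicalPhysics.QuantumFieldTheory.Chatterjee2019LargeN.CoeffCatalanBoundProof
open Literature.MathematicalPhysics.QuantumFieldTheory.Chatterjee2019LargeN.Word
  (posSplit₁ posSplit₂ negSplit₁ negSplit₂)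

namespace Summit.QuantumFields.GaugeBoot

namespace StringDuality

variable {d : ℕ}

/-! ## The weight of a middle block -/

/-- **A middle block weighs at most the whole**: `Φ(m) ≤ Φ(u ++ m ++ v)` for `K ≥ 1` and blocks without null components.
[cite: Chatterjee2019LargeN, Lemma 10.1 (the weight)] -/
theorem weight_middle_le {K : ℝ} (hK : 1 ≤ K) {u m v : LoopSeq d} (hu : ∀ l ∈ u, l ≠ []) (hm : ∀ l ∈ m, l ≠ [])
    (hv : ∀ l ∈ v, l ≠ []) : K ^ m.index * catProd m ≤ K ^ (u ++ m ++ v).index * catProd (u ++ m ++ v) := by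
  have hum : ∀ l ∈ u ++ m, l ≠ [] := fun l hl => by
    rw [List.mem_append] at hl; rcases hl with h | h; exacts [hu l h, hm l h]
  rw [Factorization.index_append hum hv, Factorization.index_append hu hm, catProd_append, catProd_append, pow_add, pow_add]
  have h1 : (1 : ℝ) ≤ K ^ u.index := one_le_pow₀ hK
  have h2 : (1 : ℝ) ≤ K ^ v.index := one_le_pow₀ hK
  have h3 := one_le_catProd u
  have h4 := one_le_catProd v
  have h0 : 0 ≤ K ^ m.index * catProd m := mul_nonneg (pow_nonneg (by linarith) _) (catProd_nonneg m)
  calc K ^ m.index * catProd m = 1 * (K ^ m.index * catProd m) * 1 := by ring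
    _ ≤ (K ^ u.index * catProd u) * (K ^ m.index * catProd m) * (K ^ v.index * catProd v) := by
        apply mul_le_mul (mul_le_mul (one_le_mul_of_one_le_of_one_le h1 h3) le_rfl h0 (by positivity)) _ zero_le_one
          (by positivity)
        exact one_le_mul_of_one_le_of_one_le h2 h4
    _ = K ^ u.index * K ^ m.index * K ^ v.index * (catProd u * catProd m * catProd v) := by ring

/-! ## The abstract factorization theorem -/

/-- ★ **First-order factorization, abstract form**: under the hypotheses of `firstOrder_defect_equation`, the bounds
`|f₀((l))| ≤ 1`, `|f₁(s)| ≤ C₁ L₁^{|s|}` and the contraction regime `K ≥ 8`, `(2L₁)² ≤ K`, `2/K + 1024(d−1)K⁴|β| ≤ 3/8`, the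
first-order coefficient is the derivation: `f₁ = Q` on genuine loop sequences.
[cite: Chatterjee2019LargeN, Corollary 3.2, Lemma 10.1; ChatterjeeJafarov2016OneOverN, Theorem 5.1] -/
theorem firstOrder_factorization_of {β K C₁ L₁ : ℝ} {f0 f1 P Q G : LoopSeq d → ℝ}
    (hK8 : 8 ≤ K) (hθ : 2 / K + |β| * (2 * ((2 * (d - 1) : ℕ) : ℝ) * 256 * K ^ 4) ≤ 3 / 8)
    (hC : 0 ≤ C₁) (hL : 1 ≤ L₁) (hLK : (2 * L₁) ^ 2 ≤ K)
    (h0nil : f0 [] = 1) (h1nil : f1 [] = 0)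
    (hP0 : P [] = 1) (hPc : ∀ (l : List (DEdge d)) (u : LoopSeq d), P (l :: u) = f0 [l] * P u)
    (hQ0 : Q [] = 0) (hQc : ∀ (l : List (DEdge d)) (u : LoopSeq d), Q (l :: u) = f1 [l] * P u + f0 [l] * Q u)
    (hG : ∀ u : LoopSeq d, G u = f1 u - Q u)
    (hmul : ∀ u : LoopSeq d, IsLoopSeq u → f0 u = P u)
    (ha1 : ∀ l : List (DEdge d), IsLoop l → l ≠ [] → |f0 [l]| ≤ 1)
    (hb : ∀ u : LoopSeq d, IsLoopSeq u → |f1 u| ≤ C₁ * L₁ ^ u.len)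
    (hE0 : ∀ u : LoopSeq d, IsLoopSeq u → u ≠ [] →
      (u.len : ℝ) * f0 u -
          ((∑ o : InvIdx u, f0 (u.negSplitAt o)) - (∑ o : SameIdx u, f0 (u.posSplitAt o))
            + β * (∑ o : DeformIdx u, f0 (u.negDeformAt o)) - β * (∑ o : DeformIdx u, f0 (u.posDeformAt o))) = 0)
    (hE1 : ∀ u : LoopSeq d, IsLoopSeq u → u ≠ [] →
      (u.len : ℝ) * f1 u -
          ((∑ o : InvIdx u, f1 (u.negSplitAt o)) - (∑ o : SameIdx u, f1 (u.posSplitAt o))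
            + β * (∑ o : DeformIdx u, f1 (u.negDeformAt o)) - β * (∑ o : DeformIdx u, f1 (u.posDeformAt o))) =
        (u.len : ℝ) * f0 u + ((∑ o : SameIdx u, f0 (u.negTwistAt o)) - ∑ o : InvIdx u, f0 (u.posTwistAt o))) :
    ∀ u : LoopSeq d, IsLoopSeq u → G u = 0 := by
  have hK1 : 1 ≤ K := by linarith
  have hK0 : 0 < K := by linarith
  have hθ0 : 0 ≤ 2 / K + |β| * (2 * ((2 * (d - 1) : ℕ) : ℝ) * 256 * K ^ 4) := by positivity
  -- (a) the a priori bound `|G| ≤ C₁ Φ`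
  have hbase : ∀ u : LoopSeq d, IsLoopSeq u → |G u| ≤ C₁ * (K ^ u.index * catProd u) := by
    intro u hu
    have hune : ∀ l ∈ u, l ≠ [] := fun l hl => (hu l hl).2
    have hQ : |Q u| ≤ u.length * (C₁ * L₁ ^ u.len) :=
      abs_derFun_le hP0 hPc hQ0 hQc hC hL (fun l hl => ha1 l (hu l hl).1 (hu l hl).2)
        (fun l hl => by
          have h := hb [l] (fun l' hl' => by rw [List.mem_singleton] at hl'; rw [hl']; exact hu l hl)
          rwa [len_singleton] at h)
    have hsz : (u.length : ℝ) ≤ u.len := by exact_mod_cast LoopSeq.size_le_len hune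
    have hlen2 : (u.len : ℝ) + 1 ≤ 2 ^ u.len := by exact_mod_cast Nat.lt_two_pow_self
    have hL1' : (0 : ℝ) ≤ L₁ ^ u.len := by positivity
    have hw : (2 * L₁) ^ u.len ≤ K ^ u.index * catProd u := pow_len_le_weight (by linarith) hLK hu
    calc |G u| = |f1 u - Q u| := by rw [hG]
      _ ≤ |f1 u| + |Q u| := abs_sub _ _
      _ ≤ C₁ * L₁ ^ u.len + u.length * (C₁ * L₁ ^ u.len) := add_le_add (hb u hu) hQ
      _ = ((u.length : ℝ) + 1) * (C₁ * L₁ ^ u.len) := by ring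
      _ ≤ 2 ^ u.len * (C₁ * L₁ ^ u.len) := mul_le_mul_of_nonneg_right (by linarith) (by positivity)
      _ = C₁ * (2 * L₁) ^ u.len := by rw [mul_pow]; ring
      _ ≤ C₁ * (K ^ u.index * catProd u) := mul_le_mul_of_nonneg_left hw hC
  -- (b) the contraction
  have hiter : ∀ (n : ℕ) (u : LoopSeq d), IsLoopSeq u → |G u| ≤ C₁ * (5 / 8 : ℝ) ^ n * (K ^ u.index * catProd u) := by
    intro n
    induction n with
    | zero => intro u hu; simpa only [pow_zero, mul_one] using hbase u hu
    | succ n ih =>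
      intro s hs
      have hsne : ∀ l ∈ s, l ≠ [] := fun l hl => (hs l hl).2
      by_cases hne : s = []
      · subst hne; rw [hG, h1nil, hQ0, sub_self, abs_zero]
        exact mul_nonneg (mul_nonneg hC (pow_nonneg (by norm_num) _)) (mul_nonneg (pow_nonneg hK0.le _) (catProd_nonneg _))
      set c : ℝ := C₁ * (5 / 8 : ℝ) ^ n with hc
      have hc0 : 0 ≤ c := mul_nonneg hC (pow_nonneg (by norm_num) _)
      have hlen : (0 : ℝ) < s.len := by exact_mod_cast LoopSeq.len_pos hs hne
      -- the two splitting weight sums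
      set S₁ : ℝ := ∑ o : InvIdx s, K ^ (s.negSplitAt o).index * catProd (s.negSplitAt o) with hS₁
      set S₂ : ℝ := ∑ o : SameIdx s, K ^ (s.posSplitAt o).index * catProd (s.posSplitAt o) with hS₂
      have hS : S₁ + S₂ ≤ (s.len : ℝ) * (2 / K) * (K ^ s.index * catProd s) := by
        have h1 := sum_invIdx_weight_le hK1 hs
        have h2 := sum_sameIdx_weight_le hK1 hs
        obtain ⟨j, hj⟩ : ∃ j : ℕ, s.index = j + 1 := ⟨s.index - 1, (Nat.sub_add_cancel (one_le_index hs hne)).symm⟩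
        rw [hj] at h1 h2 ⊢
        simp only [Nat.add_sub_cancel] at h1 h2
        have e : (s.len : ℝ) * (2 / K) * (K ^ (j + 1) * catProd s) = 2 * ((s.len : ℝ) * (K ^ j * catProd s)) := by
          rw [pow_succ]; field_simp
        rw [hS₁, hS₂, e]; linarith
      -- the source: the extra term of the defect equation
      have hsrc : |(s.len : ℝ) * G s -
          ((∑ o : InvIdx s, G (s.negSplitAt o)) - (∑ o : SameIdx s, G (s.posSplitAt o))
            + β * (∑ o : DeformIdx s, G (s.negDeformAt o)) - β * (∑ o : DeformIdx s, G (s.posDeformAt o)))| ≤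
          c * (S₁ + S₂) := by
        rw [firstOrder_defect_equation h0nil h1nil hP0 hPc hQ0 hQc hG hmul hE0 hE1 hs hne, abs_neg]
        have hPP : ∀ i : Fin s.length, |P (s.take i) * P (s.drop (i + 1))| ≤ 1 := by
          intro i
          rw [abs_mul]
          have h1 := abs_mulFun_le_one hP0 hPc (u := s.take i) fun l hl =>
            ha1 l (hs l (List.mem_of_mem_take hl)).1 (hs l (List.mem_of_mem_take hl)).2
          have h2 := abs_mulFun_le_one hP0 hPc (u := s.drop (i + 1)) fun l hl =>
            ha1 l (hs l (List.mem_of_mem_drop hl)).1 (hs l (List.mem_of_mem_drop hl)).2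
          calc |P (s.take i)| * |P (s.drop (i + 1))| ≤ 1 * 1 := mul_le_mul h1 h2 (abs_nonneg _) zero_le_one
            _ = 1 := one_mul 1
        -- the two splitting sums of `s`, by component, dominate the extra term
        have hpre : ∀ i : Fin s.length, ∀ l ∈ s.take i, l ≠ [] := fun i l hl => hsne l (List.mem_of_mem_take hl)
        have hpost : ∀ i : Fin s.length, ∀ l ∈ s.drop (i + 1), l ≠ [] := fun i l hl => hsne l (List.mem_of_mem_drop hl)
        have hloop : ∀ i : Fin s.length, IsLoop (s.get i) := fun i => (hs _ (List.get_mem s i)).1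
        have eS₁ : S₁ = ∑ i : Fin s.length, ∑ q : {xy : Fin (s.get i).length × Fin (s.get i).length //
            (s.get i).get xy.2 = DEdge.inv ((s.get i).get xy.1)},
            K ^ LoopSeq.index (s.take i ++ [negSplit₁ (s.get i) q.1.1 q.1.2, negSplit₂ (s.get i) q.1.1 q.1.2] ++ s.drop (i + 1)) *
              catProd (s.take i ++ [negSplit₁ (s.get i) q.1.1 q.1.2, negSplit₂ (s.get i) q.1.1 q.1.2] ++ s.drop (i + 1)) := by
          rw [hS₁, sum_negSplitAt_eq hsne (fun t => K ^ t.index * catProd t)]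
          exact Finset.sum_congr rfl fun i _ => Finset.sum_congr rfl fun q _ => by rw [prune_negSplit (hloop i) q.2]
        have eS₂ : S₂ = ∑ i : Fin s.length, ∑ q : {xy : Fin (s.get i).length × Fin (s.get i).length //
            xy.1 ≠ xy.2 ∧ (s.get i).get xy.2 = (s.get i).get xy.1},
            K ^ LoopSeq.index (s.take i ++ [posSplit₁ (s.get i) q.1.1 q.1.2, posSplit₂ (s.get i) q.1.1 q.1.2] ++ s.drop (i + 1)) *
              catProd (s.take i ++ [posSplit₁ (s.get i) q.1.1 q.1.2, posSplit₂ (s.get i) q.1.1 q.1.2] ++ s.drop (i + 1)) := by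
          rw [hS₂, sum_posSplitAt_eq hsne (fun t => K ^ t.index * catProd t)]
          exact Finset.sum_congr rfl fun i _ => Finset.sum_congr rfl fun q _ => by rw [prune_posSplit (hloop i) q.2.1 q.2.2]
        have hpiecesI : ∀ (i : Fin s.length) (q : {xy : Fin (s.get i).length × Fin (s.get i).length //
            (s.get i).get xy.2 = DEdge.inv ((s.get i).get xy.1)}),
            ∀ l ∈ ([negSplit₁ (s.get i) q.1.1 q.1.2, negSplit₂ (s.get i) q.1.1 q.1.2] : LoopSeq d), l ≠ [] := by
          intro i q l hl
          simp only [List.mem_cons, List.not_mem_nil, or_false] at hl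
          rcases hl with rfl | rfl
          · exact Word.negSplit₁_ne_nil (hloop i) q.2
          · exact Word.negSplit₂_ne_nil (hloop i) q.2
        have hpiecesS : ∀ (i : Fin s.length) (q : {xy : Fin (s.get i).length × Fin (s.get i).length //
            xy.1 ≠ xy.2 ∧ (s.get i).get xy.2 = (s.get i).get xy.1}),
            ∀ l ∈ ([posSplit₁ (s.get i) q.1.1 q.1.2, posSplit₂ (s.get i) q.1.1 q.1.2] : LoopSeq d), l ≠ [] := by
          intro i q l hl
          simp only [List.mem_cons, List.not_mem_nil, or_false] at hl
          rcases hl with rfl | rfl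
          · exact Word.posSplit₁_ne_nil (hloop i) q.2.1 q.2.2
          · exact Word.posSplit₂_ne_nil (hloop i) q.2.1 q.2.2
        -- genuineness of the two-loop pieces
        have gI : ∀ (i : Fin s.length) (q : {xy : Fin (s.get i).length × Fin (s.get i).length //
            (s.get i).get xy.2 = DEdge.inv ((s.get i).get xy.1)}),
            IsLoopSeq ([negSplit₁ (s.get i) q.1.1 q.1.2, negSplit₂ (s.get i) q.1.1 q.1.2] : LoopSeq d) := by
          intro i q
          have h := hs.negSplitAt ⟨i, q⟩
          have e : s.negSplitAt ⟨i, q⟩ = s.take i ++ LoopSeq.prune [negSplit₁ (s.get i) q.1.1 q.1.2, negSplit₂ (s.get i) q.1.1 q.1.2]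
              ++ s.drop (i + 1) := replaceAt_eq_append hsne i _
          rw [e, prune_negSplit (hloop i) q.2] at h
          exact isLoopSeq_middle h
        have gS : ∀ (i : Fin s.length) (q : {xy : Fin (s.get i).length × Fin (s.get i).length //
            xy.1 ≠ xy.2 ∧ (s.get i).get xy.2 = (s.get i).get xy.1}),
            IsLoopSeq ([posSplit₁ (s.get i) q.1.1 q.1.2, posSplit₂ (s.get i) q.1.1 q.1.2] : LoopSeq d) := by
          intro i q
          have h := hs.posSplitAt ⟨i, q⟩
          have e : s.posSplitAt ⟨i, q⟩ = s.take i ++ LoopSeq.prune [posSplit₁ (s.get i) q.1.1 q.1.2, posSplit₂ (s.get i) q.1.1 q.1.2]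
              ++ s.drop (i + 1) := replaceAt_eq_append hsne i _
          rw [e, prune_posSplit (hloop i) q.2.1 q.2.2] at h
          exact isLoopSeq_middle h
        calc |∑ i : Fin s.length, P (s.take i) * P (s.drop (i + 1)) *
              ((∑ q : {xy : Fin (s.get i).length × Fin (s.get i).length // (s.get i).get xy.2 = DEdge.inv ((s.get i).get xy.1)},
                  G [negSplit₁ (s.get i) q.1.1 q.1.2, negSplit₂ (s.get i) q.1.1 q.1.2])
                - ∑ q : {xy : Fin (s.get i).length × Fin (s.get i).length // xy.1 ≠ xy.2 ∧ (s.get i).get xy.2 = (s.get i).get xy.1},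
                  G [posSplit₁ (s.get i) q.1.1 q.1.2, posSplit₂ (s.get i) q.1.1 q.1.2])|
            ≤ ∑ i : Fin s.length, |P (s.take i) * P (s.drop (i + 1)) *
              ((∑ q : {xy : Fin (s.get i).length × Fin (s.get i).length // (s.get i).get xy.2 = DEdge.inv ((s.get i).get xy.1)},
                  G [negSplit₁ (s.get i) q.1.1 q.1.2, negSplit₂ (s.get i) q.1.1 q.1.2])
                - ∑ q : {xy : Fin (s.get i).length × Fin (s.get i).length // xy.1 ≠ xy.2 ∧ (s.get i).get xy.2 = (s.get i).get xy.1},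
                  G [posSplit₁ (s.get i) q.1.1 q.1.2, posSplit₂ (s.get i) q.1.1 q.1.2])| := Finset.abs_sum_le_sum_abs _ _
          _ ≤ ∑ i : Fin s.length,
              ((∑ q : {xy : Fin (s.get i).length × Fin (s.get i).length // (s.get i).get xy.2 = DEdge.inv ((s.get i).get xy.1)},
                  c * (K ^ LoopSeq.index (s.take i ++ [negSplit₁ (s.get i) q.1.1 q.1.2, negSplit₂ (s.get i) q.1.1 q.1.2] ++ s.drop (i + 1)) *
                    catProd (s.take i ++ [negSplit₁ (s.get i) q.1.1 q.1.2, negSplit₂ (s.get i) q.1.1 q.1.2] ++ s.drop (i + 1))))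
               + ∑ q : {xy : Fin (s.get i).length × Fin (s.get i).length // xy.1 ≠ xy.2 ∧ (s.get i).get xy.2 = (s.get i).get xy.1},
                  c * (K ^ LoopSeq.index (s.take i ++ [posSplit₁ (s.get i) q.1.1 q.1.2, posSplit₂ (s.get i) q.1.1 q.1.2] ++ s.drop (i + 1)) *
                    catProd (s.take i ++ [posSplit₁ (s.get i) q.1.1 q.1.2, posSplit₂ (s.get i) q.1.1 q.1.2] ++ s.drop (i + 1)))) := by
            refine Finset.sum_le_sum fun i _ => ?_
            rw [abs_mul]
            refine (mul_le_mul (hPP i) le_rfl (abs_nonneg _) zero_le_one).trans ?_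
            rw [one_mul]
            refine (abs_sub _ _).trans (add_le_add ?_ ?_)
            · refine (Finset.abs_sum_le_sum_abs _ _).trans (Finset.sum_le_sum fun q _ => ?_)
              exact (ih _ (gI i q)).trans (mul_le_mul_of_nonneg_left
                (weight_middle_le hK1 (hpre i) (hpiecesI i q) (hpost i)) hc0)
            · refine (Finset.abs_sum_le_sum_abs _ _).trans (Finset.sum_le_sum fun q _ => ?_)
              exact (ih _ (gS i q)).trans (mul_le_mul_of_nonneg_left
                (weight_middle_le hK1 (hpre i) (hpiecesS i q) (hpost i)) hc0)
          _ = c * (S₁ + S₂) := by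
            rw [eS₁, eS₂, mul_add, Finset.mul_sum, Finset.mul_sum, ← Finset.sum_add_distrib]
            refine Finset.sum_congr rfl fun i _ => ?_
            rw [Finset.mul_sum, Finset.mul_sum]
      -- contract
      have hstep := contraction_step (β := β) hK1 hc0 le_rfl hs hne G hsrc
        (fun o => ih _ (hs.negSplitAt o)) (fun o => ih _ (hs.posSplitAt o))
        (fun o => ih _ (hs.negDeformAt o)) (fun o => ih _ (hs.posDeformAt o))
      have hΦ0 : 0 ≤ K ^ s.index * catProd s := mul_nonneg (pow_nonneg hK0.le _) (catProd_nonneg _)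
      have h2K : 2 / K ≤ 1 / 4 := by rw [div_le_iff₀ hK0]; linarith
      calc |G s| ≤ c * (2 / K + |β| * (2 * ((2 * (d - 1) : ℕ) : ℝ) * 256 * K ^ 4)) * (K ^ s.index * catProd s)
            + c * (S₁ + S₂) / s.len := hstep
        _ ≤ c * (3 / 8) * (K ^ s.index * catProd s) + c * (2 / K) * (K ^ s.index * catProd s) := by
            refine add_le_add (mul_le_mul_of_nonneg_right (mul_le_mul_of_nonneg_left hθ hc0) hΦ0) ?_
            rw [div_le_iff₀ hlen]
            calc c * (S₁ + S₂) ≤ c * ((s.len : ℝ) * (2 / K) * (K ^ s.index * catProd s)) := mul_le_mul_of_nonneg_left hS hc0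
              _ = c * (2 / K) * (K ^ s.index * catProd s) * s.len := by ring
        _ ≤ c * (5 / 8) * (K ^ s.index * catProd s) := by
            have h4 : c * (2 / K) * (K ^ s.index * catProd s) ≤ c * (1 / 4) * (K ^ s.index * catProd s) :=
              mul_le_mul_of_nonneg_right (mul_le_mul_of_nonneg_left h2K hc0) hΦ0
            linarith
        _ = C₁ * (5 / 8 : ℝ) ^ (n + 1) * (K ^ s.index * catProd s) := by rw [hc, pow_succ]; ring
  -- (c) conclusion
  intro u hu
  have hlim : Tendsto (fun n : ℕ => C₁ * (5 / 8 : ℝ) ^ n * (K ^ u.index * catProd u)) atTop (𝓝 0) := by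
    have h := ((tendsto_pow_atTop_nhds_zero_of_lt_one (by norm_num : (0 : ℝ) ≤ 5 / 8)
      (by norm_num : (5 / 8 : ℝ) < 1)).const_mul C₁).mul_const (K ^ u.index * catProd u)
    simpa only [mul_zero, zero_mul] using h
  have habs : |G u| ≤ 0 := ge_of_tendsto' hlim fun n => hiter n u hu
  exact abs_nonpos_iff.mp habs

end StringDuality

end Summit.QuantumFields.GaugeBoot

end
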